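import Mathlib

/-!
# The tame shift of a conductor-`𝔩ⁿ` CM point is not independent of `n` (T3.2 / R-B.4, complex placement)

Blind re-derivation cell `pub-hodge-repro`, Tier 3, seat `t3-p2` (prover-pub-hodge-repro-t3-p2-g3-0).  Target tree path
`lean/Summits/Ventures/HodgeRepro/Tier3TameShift.lean`.  Imports: Mathlib only.  Paper: `proofs/t3-p2/T3-P2-NOTE-g3-TAMESHIFT.md`
(a correction to lead g111's INBOX L6576 (2)).

## What is on the page (He, Math. Ann. 392 (2025), author copy `paper:arxiv-2308.15051`)

* p0017:L20 — the embedding `ρ : K^× → GL₂(F)`, `ρ(x + yϑ) = (x, yϑ²; y, x)`;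
* p0017:L44–45 — the conductor-`ϖⁿ` conjugators at the tower prime `𝔩`,
  `ς_{𝔩,n} = (−ϖ^{n−δ} a_𝔩, 1; ϖⁿ, 0)`;
* p0014:L42–43 (assumption (*)(2)) — the stabiliser of the CM point `[ρ(a) ς_n]` at the fixed level `U₀(𝔭)` is exactly
  the order of conductor `ϖⁿ`; p0016:L2–15 (Remark 4.9) — the tower moves `ς`, the `U₀(𝔭)`-invariant section is fixed.

## What this file proves (all elementary, over an arbitrary field `K`; `θ2 := ϑ²`, `b := ϖ^{−δ} a_𝔩`)

* `S_eq_S_zero_mul_diagonal` — `ς_{𝔩,n} = ς_{𝔩,0} · diag(ϖⁿ, 1)`;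
* `conj_formula` — for `d = x + yϑ` the shift `c_{d,n} := ς_{𝔩,n}⁻¹ ρ(d) ς_{𝔩,n}` is
  `(x − y b, y ϖ^{−n}; ϖⁿ y (ϑ² − b²), x + y b)`;
* `conj_eq_diagonal_conj` — `c_{d,n} = diag(ϖ^{−n}, 1) · c_{d,0} · diag(ϖⁿ, 1)`;
* `conj_ne_of_pow_ne` — for `y ≠ 0` (every `d ∉ F_𝔩`, in particular every tame class) and `ϖⁿ ≠ ϖᵐ`, the shifts
  `c_{d,n}` and `c_{d,m}` DIFFER: the `(0,1)` entry is `y ϖ^{−n}`.  So the «fixed `c_d`» of L6576 (2) does not exist.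
* `eq_rho_of_commute` — the centraliser of a non-central `ρ(x + yϑ)` (`y ≠ 0`) inside `M₂(K)` is `ρ(K)`:
  a matrix commuting with it is `ρ(p + rϑ)` for its own entries `p = A 0 0`, `r = A 1 0`;
* `exists_rho_mul_of_conj_eq` — the convention-free statement: if two conjugators `s, t` (with left inverses) give the
  SAME conjugate of one non-central `ρ(d)`, then `t = ρ(k) · s` for some `k = p + rϑ`, i.e. `t ∈ ρ(K) · s` — the two CM
  points lie in ONE toric orbit, so their conductors agree.  Hence no sequence `(ς_n)` with growing conductor has an
  `n`-independent tame shift.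

Nothing here says anything about the status of the Hodge conjecture for CM abelian varieties, which is NOT proved.
-/

set_option autoImplicit false

namespace HodgeRepro.T3.TameShift

open Matrix

variable {K : Type*} [Field K]

/-! Notation-free conventions.  He's embedding in the basis `(1, ϑ)`, `ρ(x + yϑ) = (x, yϑ²; y, x)` with `θ2 = ϑ²`
(p0017:L20), appears below literally as `!![x, y * θ2; y, x]`; He's conjugator `ς_{𝔩,n} = (−ϖ^{n−δ} a, 1; ϖⁿ, 0)`
(p0017:L44–45), with `b := ϖ^{−δ} a`, as `!![-(ϖ ^ n * b), 1; ϖ ^ n, 0]` (so `ς_{𝔩,0} = !![-b, 1; 1, 0]`); the inverse of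
`ς_{𝔩,n}` (for `ϖ ≠ 0`) as `!![0, (ϖ ^ n)⁻¹; 1, b]` (so `ς_{𝔩,0}⁻¹ = !![0, 1; 1, b]`).  No definitions or notations are
introduced: every statement is literally about explicit `2 × 2` matrices over a field. -/

/-- `ς_{𝔩,n}⁻¹ · ς_{𝔩,n} = 1` (for `ϖ ≠ 0`). -/
theorem Sinv_mul_S {ϖ b : K} (hϖ : ϖ ≠ 0) (n : ℕ) : !![0, (ϖ ^ n)⁻¹; 1, b] * !![-(ϖ ^ n * b), 1; ϖ ^ n, 0] = 1 := by
  have h : ϖ ^ n ≠ 0 := pow_ne_zero n hϖ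
  ext i j
  fin_cases i <;> fin_cases j <;> simp [Matrix.mul_apply, Fin.sum_univ_two, h]
  ring

/-- `ς_{𝔩,n} · ς_{𝔩,n}⁻¹ = 1` (for `ϖ ≠ 0`). -/
theorem S_mul_Sinv {ϖ b : K} (hϖ : ϖ ≠ 0) (n : ℕ) : !![-(ϖ ^ n * b), 1; ϖ ^ n, 0] * !![0, (ϖ ^ n)⁻¹; 1, b] = 1 := by
  have h : ϖ ^ n ≠ 0 := pow_ne_zero n hϖ
  ext i j
  fin_cases i <;> fin_cases j <;> simp [Matrix.mul_apply, Fin.sum_univ_two, h]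
  rw [mul_right_comm, mul_inv_cancel₀ h, one_mul, neg_add_cancel]

/-- `ς_{𝔩,n} = ς_{𝔩,0} · diag(ϖⁿ, 1)`: the tower is the right translate by `diag(ϖⁿ, 1)` of the conductor-one
conjugator. -/
theorem S_eq_S_zero_mul_diagonal (ϖ b : K) (n : ℕ) : !![-(ϖ ^ n * b), 1; ϖ ^ n, 0] = !![-b, 1; 1, 0] * diagonal ![ϖ ^ n, 1] := by
  ext i j
  fin_cases i <;> fin_cases j <;> simp [Matrix.mul_apply, Fin.sum_univ_two]
  ring

/-- The shift `c_{d,n} = ς_{𝔩,n}⁻¹ ρ(x + yϑ) ς_{𝔩,n}`, explicitly. -/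
theorem conj_formula {ϖ b : K} (hϖ : ϖ ≠ 0) (θ2 x y : K) (n : ℕ) :
    !![0, (ϖ ^ n)⁻¹; 1, b] * !![x, y * θ2; y, x] * !![-(ϖ ^ n * b), 1; ϖ ^ n, 0] =
      !![x - y * b, y * (ϖ ^ n)⁻¹; ϖ ^ n * (y * (θ2 - b ^ 2)), x + y * b] := by
  have h : ϖ ^ n ≠ 0 := pow_ne_zero n hϖ
  ext i j
  fin_cases i <;> fin_cases j <;> simp [Matrix.mul_apply, Fin.sum_univ_two] <;>
    field_simp <;> ring

/-- `c_{d,n} = diag(ϖ^{−n}, 1) · c_{d,0} · diag(ϖⁿ, 1)`: the shift is the `diag(ϖⁿ,1)`-conjugate of the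
conductor-one shift, with the off-diagonal entries scaled by `ϖ^{∓n}`. -/
theorem conj_eq_diagonal_conj {ϖ b : K} (hϖ : ϖ ≠ 0) (θ2 x y : K) (n : ℕ) :
    !![0, (ϖ ^ n)⁻¹; 1, b] * !![x, y * θ2; y, x] * !![-(ϖ ^ n * b), 1; ϖ ^ n, 0] =
      diagonal ![(ϖ ^ n)⁻¹, 1] * (!![0, 1; 1, b] * !![x, y * θ2; y, x] * !![-b, 1; 1, 0]) * diagonal ![ϖ ^ n, 1] := by
  have h : ϖ ^ n ≠ 0 := pow_ne_zero n hϖ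
  rw [conj_formula hϖ]
  ext i j
  fin_cases i <;> fin_cases j <;> simp [Matrix.mul_apply, Fin.sum_univ_two] <;> field_simp <;> ring

/-- The `(0,1)` entry of the shift is `y ϖ^{−n}`. -/
theorem conj_apply_zero_one {ϖ b : K} (hϖ : ϖ ≠ 0) (θ2 x y : K) (n : ℕ) :
    (!![0, (ϖ ^ n)⁻¹; 1, b] * !![x, y * θ2; y, x] * !![-(ϖ ^ n * b), 1; ϖ ^ n, 0]) 0 1 = y * (ϖ ^ n)⁻¹ := by
  rw [conj_formula hϖ]; rfl

/-- **The tame shift depends on `n`.**  For `y ≠ 0` (every `d = x + yϑ ∉ F_𝔩`, in particular every tame class) and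
`ϖⁿ ≠ ϖᵐ` (e.g. a uniformiser and `n ≠ m`), the shifts at conductors `ϖⁿ` and `ϖᵐ` differ. -/
theorem conj_ne_of_pow_ne {ϖ b : K} (hϖ : ϖ ≠ 0) (θ2 x y : K) {n m : ℕ} (hy : y ≠ 0)
    (hnm : ϖ ^ n ≠ ϖ ^ m) :
    !![0, (ϖ ^ n)⁻¹; 1, b] * !![x, y * θ2; y, x] * !![-(ϖ ^ n * b), 1; ϖ ^ n, 0] ≠ !![0, (ϖ ^ m)⁻¹; 1, b] * !![x, y * θ2; y, x] * !![-(ϖ ^ m * b), 1; ϖ ^ m, 0] := by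
  intro heq
  have h1 := congrArg (fun A : Matrix (Fin 2) (Fin 2) K => A 0 1) heq
  simp only [conj_apply_zero_one hϖ] at h1
  apply hnm
  have h2 : (ϖ ^ n)⁻¹ = (ϖ ^ m)⁻¹ := mul_left_cancel₀ hy h1
  exact inv_injective h2

/-- **The centraliser of a non-central element of `ρ(K)` is `ρ(K)`.**  If `A` commutes with `ρ(x + yϑ)`, `y ≠ 0`, then
`A = ρ(p + rϑ)` with `p = A 0 0`, `r = A 1 0`. -/
theorem eq_rho_of_commute {θ2 x y : K} (hy : y ≠ 0) {A : Matrix (Fin 2) (Fin 2) K}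
    (hA : A * !![x, y * θ2; y, x] = !![x, y * θ2; y, x] * A) :
    A = !![A 0 0, A 1 0 * θ2; A 1 0, A 0 0] := by
  have h00 := congrArg (fun M : Matrix (Fin 2) (Fin 2) K => M 0 0) hA
  have h10 := congrArg (fun M : Matrix (Fin 2) (Fin 2) K => M 1 0) hA
  simp only [Matrix.mul_apply, Fin.sum_univ_two, of_apply, cons_val', cons_val_zero, cons_val_one,
    empty_val', cons_val_fin_one] at h00 h10
  -- h00 : A 0 0 * x + A 0 1 * y = x * A 0 0 + y * θ2 * A 1 0 ;  h10 : A 1 0 * x + A 1 1 * y = y * A 0 0 + x * A 1 0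
  have e01 : A 0 1 = A 1 0 * θ2 := by
    have : A 0 1 * y = (A 1 0 * θ2) * y := by linear_combination h00
    exact mul_right_cancel₀ hy this
  have e11 : A 1 1 = A 0 0 := by
    have : A 1 1 * y = A 0 0 * y := by linear_combination h10
    exact mul_right_cancel₀ hy this
  ext i j
  fin_cases i <;> fin_cases j <;> simp [e01, e11]

/-- **Convention-free form of the correction.**  Two conjugators `s, t` (with left inverses `s', t'`) giving the same
conjugate of one non-central `ρ(d)` differ by an element of `ρ(K)` on the left: `t = ρ(k) · s`.  For the tower this says
`ς_m ∈ ρ(K_𝔩^×) · ς_n`, so the CM points `[ρ(a) ς_m]` and `[ρ(a) ς_n]` lie in one toric orbit and have the same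
conductor — a fixed tame shift is incompatible with a growing conductor. -/
theorem exists_rho_mul_of_conj_eq {θ2 x y : K} (hy : y ≠ 0) {s s' t t' : Matrix (Fin 2) (Fin 2) K}
    (hs : s' * s = 1) (ht : t' * t = 1)
    (H : s' * !![x, y * θ2; y, x] * s = t' * !![x, y * θ2; y, x] * t) :
    ∃ p r : K, t = !![p, r * θ2; r, p] * s := by
  have hs2 : s * s' = 1 := mul_eq_one_comm.mp hs
  have htt : t * t' = 1 := mul_eq_one_comm.mp ht
  -- `t * s'` commutes with `ρ(d)`
  have hcomm : (t * s') * !![x, y * θ2; y, x] = !![x, y * θ2; y, x] * (t * s') := by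
    calc (t * s') * !![x, y * θ2; y, x] = t * (s' * !![x, y * θ2; y, x] * s) * s' := by
          rw [show t * (s' * !![x, y * θ2; y, x] * s) * s' = (t * s') * !![x, y * θ2; y, x] * (s * s') by
            simp only [Matrix.mul_assoc], hs2, Matrix.mul_one]
      _ = t * (t' * !![x, y * θ2; y, x] * t) * s' := by rw [H]
      _ = !![x, y * θ2; y, x] * (t * s') := by
          rw [show t * (t' * !![x, y * θ2; y, x] * t) * s' = (t * t') * !![x, y * θ2; y, x] * (t * s') by
            simp only [Matrix.mul_assoc], htt, Matrix.one_mul]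
  refine ⟨(t * s') 0 0, (t * s') 1 0, ?_⟩
  rw [← eq_rho_of_commute hy hcomm, Matrix.mul_assoc, hs, Matrix.mul_one]

/-- **The mechanism of (ii-a), the P-rational part.**  In a product of groups (the places away from `𝔩` × the place
`𝔩`), a shift `g` whose `𝔩`-component is `1` is conjugated by `(a, bₙ)` — `a = ς^{(𝔩)}` fixed, `bₙ = ς_{𝔩,n}` moving
with the conductor — to `(a⁻¹ g.1 a, 1)`, which does not depend on `bₙ`.  So for a P-rational shift (Cornut–Vatsal Def 2.8:
`𝔩`-component in `K^× F_𝔩^×`, i.e. trivial at `𝔩` after absorbing `ρ(k) ∈ G(F)` on the left and the central `ρ(f)`) the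
right translate `c` with `x_n(λ′a) = x_n(a) · c` is FIXED and lives away from `𝔩`. -/
theorem conj_prod_of_snd_eq_one {G H : Type*} [Group G] [Group H] (a : G) (b : H) (g : G × H)
    (hg : g.2 = 1) : (a, b)⁻¹ * g * (a, b) = (a⁻¹ * g.1 * a, 1) := by
  ext
  · rfl
  · simp [hg]

end HodgeRepro.T3.TameShift
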